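import Summits.QuantumFields.BalabanUV.T4Continuum.Support.ScalarPlantingConsistency
import Summits.QuantumFields.BalabanUV.T4Continuum.Support.GramPerturbationLaw

/-!
# T⁴ programme, spine node NE2 (U1a) — THE COLOUR SCALAR LAYER, file 2c: `PerturbationLaws` FOR `P_s = S_U − Δ′ ⊗ 1` ALONG THE
# SCALAR TOWER — THE END OF ROW B4.e (tier B supplier row of `t4/formal/NE2/LEAVES.md`)

NE2 formalisation swarm `b2b-balaban-t4-ne2-formalise-*`, leaf 01 (row B4.e, file 2c = the row's END; companions p208899, p209123,
`ScalarPlantingFaces`, `ScalarPlantingConsistency`).  Along the scalar tower `n_k = L^k` of row B4.c/B4.d (`Δ′_k = DeltaPs (lev L k) M a′`,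
King's 0-form plantings `J₀,k = J0pcT L M k` of leaf 04) the scalar-layer perturbation `P_{s,k} = scalarPert (lev L k) M a′ (R_k) (T_k)` of
[B9] (3.24)-shape (`S_U = D_Rᴴ D_R + a′·(B·siteMul T)ᴴ(B·siteMul T)`, transporters `R_k`, site transports `T_k` as DATA) satisfies
**`BackgroundResolventTower.PerturbationLaws (Δ′_k ⊗ 1) P_{s,k} (J₀,k ⊗ 1) κ_s e₂ˢ`** — THE INPUT OF ROW B4.b's `perturbed_injected_law`
(leaf 05's `LayerLaws.injected_le` / `complement_le` for the background family):
 * §1 the hypothesis SHAPES on the data (asserted by nobody): **`ConnectionLaws0`** (size `α`, lattice-Lipschitz `β/n_k`, two-level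
   consistency `β′/n_k` of the connection `w = n(R − 1)`, and `ζ/n_k` of the zeroth-order field `z`, cf. tier A's `LipschitzBackgroundM` +
   `BoundedBackgroundM`) and **`SiteTransportLaws0`** (`‖T − 1‖ ≤ τ`, `‖T_{k+1} − T_k ∘ par‖ ≤ τ′/n_k`);
 * §2 the free scalar averagings `B_k = Bs o (lev L k) M` and the transport errors `E_k = B_k·(siteMul T_k − 1)` are `AveragingLaws`
   families (**`averagingLaws_Bs`**: size 1, pairing 0 EXACTLY by `Bs_mul_kronJK0`; **`averagingLaws_Es`**: size τ, pairing `g·τ′/n_k`), so the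
   Gram summand `a′·((B·siteMul T)ᴴ(B·siteMul T) − BᴴB) = gramPert a′ B E` inherits `PerturbationLaws` from `GramPerturbationLaw` given ANY
   (lifted) free scalar tower `hfree : FreeTowerLaws (Δ′ ⊗ 1) A (J₀ ⊗ 1) F r e₀ e₁ f₀` (row B4.d, taken BY HYPOTHESIS in its tree shape);
 * §3 THE END **`perturbationLaws_scalarLayer`**: (H-bd) = file 1b (`κ_s = kappaS d a′ α β τ`), (H-cons) = the sum of the three local
   two-level bounds of `ScalarPlantingConsistency` (first order, adjoint, zeroth order; complement number `e₀ k` of `hfree`) and the Gram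
   bound, `e₂ˢ = e2S d L a′ α β β′ ζ τ τ′ e₀ e₁` DISPLAYED (linear in `β′/n_k`, `ζ/n_k`, `τ′/n_k`, `e₀ k`, `e₁ k`).

HONEST FRAMING (T4-DAG p. 1).  [folklore] bookkeeping, OURS, at MODEL level: transporters, site transports and every number are DATA;
the scalar layer only; supplier of row B4.b, NOT B4, NOT NE2; NOT [B9] (3.23)–(3.26) as printed; no dictionary (B0) asserted; spine count
0/9 UNCHANGED; NOT infinite volume / mass gap / Clay.  HONEST DEPENDENCY LINE: continuum YM on T⁴ ⇐ BetaPertH ∧ nine spine estimates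
(0/9 proved); BetaPertH ⇐ (D1) ∧ (D4) ∧ CAP+tail; G-an2-4 gates asym, D1 and NE2/3/4.  ABSOLUTE RULE kept; no `sorry`.
-/

noncomputable section

open scoped BigOperators ComplexConjugate Matrix Matrix.Norms.L2Operator Kronecker

namespace Summit.QuantumFields.BalabanUV.T4Continuum.ScalarCovariantLaplacianLaws

open Literature.MathematicalPhysics.QuantumFieldTheory.Balaban1983to89.B5Prop11Plancherel (Tor fine unitVec)
open Literature.MathematicalPhysics.QuantumFieldTheory.Balaban1983to89.B5Action121 (shiftS sdiff)
open Literature.MathematicalPhysics.QuantumFieldTheory.Balaban1983to89.B5G183RateUnitTower (lev lev_neZero)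
open Summit.QuantumFields.BalabanUV.T4Continuum
open Summit.QuantumFields.BalabanUV.T4Continuum.KroneckerLift
open Summit.QuantumFields.BalabanUV.T4Continuum.BlockMultiplication
open Summit.QuantumFields.BalabanUV.T4Continuum.BackgroundResolventTower
open Summit.QuantumFields.BalabanUV.T4Continuum.BalabanAveragedTowerUnit (one_le_lev' cast_lev')
open Summit.QuantumFields.BalabanUV.T4Continuum.BalabanAveragedTowerModes (par)
open Summit.QuantumFields.BalabanUV.T4Continuum.GramPerturbationLaw (AveragingLaws gramPert gramCore e2gram perturbationLaws_gramPert)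
open Summit.QuantumFields.BalabanUV.T4Continuum.ScalarAveragedPropagator (DeltaPs gammaPs Gps gammaPs_pos opNorm_Gps_le)
open Summit.QuantumFields.BalabanUV.T4Continuum.ScalarBlockPlanting (JK0 Pi0 JK0_mul_conjTranspose opNorm_JK0_le)
open Summit.QuantumFields.BalabanUV.T4Continuum.ScalarPlantingDefect (J0pcT)
open Summit.QuantumFields.BalabanUV.T4Continuum.ScalarCovariantLaplacian
open Summit.QuantumFields.BalabanUV.T4Continuum.ScalarPlantingFaces
open Summit.QuantumFields.BalabanUV.T4Continuum.ScalarPlantingConsistency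

variable {d : ℕ}

/-! ## §0 Two bookkeeping inequalities for (H-cons) of a sum -/

section Algebra

variable {α β : Type*} [Fintype α] [DecidableEq α] [Fintype β] [DecidableEq β]

omit [DecidableEq β] in
/-- (H-cons) is subadditive. [folklore] -/
theorem opNorm_cons_add_le (G' : Matrix β β ℂ) (G : Matrix α α ℂ) (J : Matrix β α ℂ) (P₁' P₂' : Matrix β β ℂ) (P₁ P₂ : Matrix α α ℂ) :
    ‖G' * ((P₁' + P₂') * J - J * (P₁ + P₂)) * G‖ ≤ ‖G' * (P₁' * J - J * P₁) * G‖ + ‖G' * (P₂' * J - J * P₂) * G‖ := by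
  have e : G' * ((P₁' + P₂') * J - J * (P₁ + P₂)) * G = G' * (P₁' * J - J * P₁) * G + G' * (P₂' * J - J * P₂) * G := by
    simp only [Matrix.add_mul, Matrix.mul_add, Matrix.sub_mul, Matrix.mul_sub]; abel
  rw [e]; exact norm_add_le _ _

omit [DecidableEq β] in
/-- (H-cons) is subadditive over finite sums. [folklore] -/
theorem opNorm_cons_sum_le {σ : Type*} (s : Finset σ) (G' : Matrix β β ℂ) (G : Matrix α α ℂ) (J : Matrix β α ℂ)
    (P' : σ → Matrix β β ℂ) (P : σ → Matrix α α ℂ) :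
    ‖G' * ((∑ i ∈ s, P' i) * J - J * ∑ i ∈ s, P i) * G‖ ≤ ∑ i ∈ s, ‖G' * (P' i * J - J * P i) * G‖ := by
  have e : G' * ((∑ i ∈ s, P' i) * J - J * ∑ i ∈ s, P i) * G = ∑ i ∈ s, G' * (P' i * J - J * P i) * G := by
    rw [Matrix.sum_mul, Matrix.mul_sum, ← Finset.sum_sub_distrib, Matrix.mul_sum, Matrix.sum_mul]
  rw [e]; exact norm_sum_le _ _

end Algebra

section Tower

variable (L : ℕ) [NeZero L] (M : Fin d → ℕ) [hM : ∀ μ, NeZero (M μ)] {o : Type*} [Fintype o] [DecidableEq o]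

/-! ## §1 The hypothesis shapes on the data -/

/-- **THE CONNECTION DATA OF THE SCALAR LAYER** (a hypothesis SHAPE on the bond transporters `R_k`, asserted by nobody): the connection
`w^{(k)}_μ = n_k(R^{(k)}_μ − 1)` has size `α`, lattice-Lipschitz constant `β/n_k`, two-level consistency `β′/n_k` at the block parent, and its
zeroth-order field `z^{(k)}` (`ScalarCovariantLaplacian.zfieldS`) two-level consistency `ζ/n_k`. [folklore] -/
structure ConnectionLaws0 (Rb : (k : ℕ) → Fin d → (Tor (fine (lev L k) M) → Matrix o o ℂ)) (α β β' ζ : ℝ) : Prop where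
  /-- `α, β, β′, ζ ≥ 0` -/
  nonneg : 0 ≤ α ∧ 0 ≤ β ∧ 0 ≤ β' ∧ 0 ≤ ζ
  /-- size -/
  bound : ∀ k μ x, ‖connS (fine (lev L k) M) ((lev L k : ℕ) : ℂ) (Rb k) μ x‖ ≤ α
  /-- lattice-Lipschitz at spacing `L^{−k}` -/
  lipschitz : ∀ k μ ν x, ‖connS (fine (lev L k) M) ((lev L k : ℕ) : ℂ) (Rb k) μ (x + unitVec (fine (lev L k) M) ν)
    - connS (fine (lev L k) M) ((lev L k : ℕ) : ℂ) (Rb k) μ x‖ ≤ β / (lev L k : ℕ)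
  /-- two-spacing consistency of the connection at the block parent -/
  consistent : ∀ k μ (x' : Tor (fine (lev L (k + 1)) M)), ‖connS (fine (lev L (k + 1)) M) ((lev L (k + 1) : ℕ) : ℂ) (Rb (k + 1)) μ x'
    - connS (fine (lev L k) M) ((lev L k : ℕ) : ℂ) (Rb k) μ (par (lev L k) L M x')‖ ≤ β' / (lev L k : ℕ)
  /-- two-spacing consistency of the zeroth-order field at the block parent -/
  zeroth_consistent : ∀ k (x' : Tor (fine (lev L (k + 1)) M)), ‖zfieldS (fine (lev L (k + 1)) M) ((lev L (k + 1) : ℕ) : ℂ) (Rb (k + 1)) x'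
    - zfieldS (fine (lev L k) M) ((lev L k : ℕ) : ℂ) (Rb k) (par (lev L k) L M x')‖ ≤ ζ / (lev L k : ℕ)

/-- **THE SITE-TRANSPORT DATA OF THE SCALAR LAYER** (hypothesis SHAPE): `‖T_k(x) − 1‖ ≤ τ` and `‖T_{k+1}(x′) − T_k(par x′)‖ ≤ τ′/n_k`. [folklore] -/
structure SiteTransportLaws0 (T : (k : ℕ) → (Tor (fine (lev L k) M) → Matrix o o ℂ)) (τ τ' : ℝ) : Prop where
  /-- `τ, τ′ ≥ 0` -/
  nonneg : 0 ≤ τ ∧ 0 ≤ τ'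
  /-- small field -/
  sub_one_le : ∀ k x, ‖T k x - 1‖ ≤ τ
  /-- two-spacing consistency at the block parent -/
  consistent : ∀ k (x' : Tor (fine (lev L (k + 1)) M)), ‖T (k + 1) x' - T k (par (lev L k) L M x')‖ ≤ τ' / (lev L k : ℕ)

/-! ## §2 The free scalar averagings and the transport errors as `AveragingLaws` families -/

/-- `B_{k+1}·(J₀,k ⊗ 1) = B_k` along the tower (`Bs_mul_kronJK0`). [folklore] -/
theorem Bs_succ_mul_J0 (k : ℕ) :
    Bs o (lev L (k + 1)) M * (J0pcT L M k ⊗ₖ (1 : Matrix o o ℂ)) = Bs o (lev L k) M := Bs_mul_kronJK0 (lev L k) L M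

/-- `(J₀,k ⊗ 1)·siteMul w = siteMul (w ∘ par)·(J₀,k ⊗ 1)` along the tower. [folklore] -/
theorem J0_mul_siteMul (k : ℕ) (w : Tor (fine (lev L k) M) → Matrix o o ℂ) :
    J0pcT L M k ⊗ₖ (1 : Matrix o o ℂ) * siteMul w
      = siteMul (fun x' : Tor (fine (lev L (k + 1)) M) => w (par (lev L k) L M x')) * J0pcT L M k ⊗ₖ (1 : Matrix o o ℂ) :=
  kronJK0_mul_siteMul (lev L k) L M w

/-- `J₀,k·J₀,kᴴ = Π₀` along the tower. [folklore] -/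
theorem J0pcT_mul_conjTranspose (k : ℕ) : J0pcT L M k * (J0pcT L M k)ᴴ = Pi0 (lev L k) L M :=
  JK0_mul_conjTranspose (lev L k) L M

/-- **the free scalar averagings are an `AveragingLaws` family**: size 1, pairing 0. [folklore] -/
theorem averagingLaws_Bs (a' : ℝ) :
    AveragingLaws (fun k => DeltaPs (lev L k) M a' ⊗ₖ (1 : Matrix o o ℂ)) (fun k => Bs o (lev L k) M)
      (fun k => J0pcT L M k ⊗ₖ (1 : Matrix o o ℂ)) 1 (fun _ => 0) where
  opNorm_le := fun k => opNorm_Bs_le o (lev L k) M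
  pair_mul_inv_le := fun k => by rw [Bs_succ_mul_J0, sub_self, Matrix.zero_mul, norm_zero]
  inv_mul_pair_le := fun k => by rw [Bs_succ_mul_J0, sub_self, Matrix.conjTranspose_zero, Matrix.mul_zero, norm_zero]

/-- the transport error of the scalar averaging `E_k = B_k·(siteMul T_k − 1)` (`B_k + E_k = B_k·siteMul T_k = (Q′ ⊗ 1)(U)` normalised). [folklore] -/
def Es (T : (k : ℕ) → (Tor (fine (lev L k) M) → Matrix o o ℂ)) (k : ℕ) : Matrix (Tor M × o) (Tor (fine (lev L k) M) × o) ℂ :=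
  Bs o (lev L k) M * (siteMul (T k) - 1)

/-- `B_k + E_k = B_k·siteMul T_k`. [folklore] -/
theorem Bs_add_Es (T : (k : ℕ) → (Tor (fine (lev L k) M) → Matrix o o ℂ)) (k : ℕ) :
    Bs o (lev L k) M + Es L M T k = Bs o (lev L k) M * siteMul (T k) := by
  rw [Es, Matrix.mul_sub, Matrix.mul_one, add_sub_cancel]

/-- the two-level pairing of the transport errors: `E_{k+1}J₀ − E_k = B_{k+1}·siteMul(T_{k+1} − T_k ∘ par)·J₀`. [folklore] -/
theorem Es_succ_mul_J0_sub (T : (k : ℕ) → (Tor (fine (lev L k) M) → Matrix o o ℂ)) (k : ℕ) :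
    Es L M T (k + 1) * (J0pcT L M k ⊗ₖ (1 : Matrix o o ℂ)) - Es L M T k
      = Bs o (lev L (k + 1)) M * siteMul (fun x' => T (k + 1) x' - T k (par (lev L k) L M x'))
          * (J0pcT L M k ⊗ₖ (1 : Matrix o o ℂ)) := by
  have hJ := J0_mul_siteMul L M k (T k) (o := o)
  rw [Es, Es, ← Bs_succ_mul_J0 L M k, siteMul_sub]
  simp only [Matrix.mul_sub, Matrix.sub_mul, Matrix.mul_one, Matrix.mul_assoc, hJ]
  abel

/-- **the transport errors are an `AveragingLaws` family**: size `τ`, sandwiched pairings `g·τ′/n_k`. [folklore] -/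
theorem averagingLaws_Es {a' : ℝ} (ha' : 0 < a') {T : (k : ℕ) → (Tor (fine (lev L k) M) → Matrix o o ℂ)} {τ τ' : ℝ}
    (hT : SiteTransportLaws0 L M T τ τ') :
    AveragingLaws (fun k => DeltaPs (lev L k) M a' ⊗ₖ (1 : Matrix o o ℂ)) (Es L M T)
      (fun k => J0pcT L M k ⊗ₖ (1 : Matrix o o ℂ)) τ (fun k => (gammaPs d a')⁻¹ * (τ' / (lev L k : ℕ))) where
  opNorm_le := fun k => by
    have e : Es L M T k = Bs o (lev L k) M * siteMul (fun x => T k x - 1) := by rw [Es, siteMul_sub, siteMul_one]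
    rw [e]
    exact (Matrix.l2_opNorm_mul _ _).trans ((mul_le_mul (opNorm_Bs_le o (lev L k) M) (opNorm_siteMul_le _ hT.nonneg.1 (hT.sub_one_le k))
      (norm_nonneg _) zero_le_one).trans (le_of_eq (one_mul _)))
  pair_mul_inv_le := fun k => by
    have hg : 0 ≤ (gammaPs d a')⁻¹ := inv_nonneg.mpr (gammaPs_pos (d := d) (a' := a')).1.le
    have hδ : 0 ≤ τ' / (lev L k : ℕ) := div_nonneg hT.nonneg.2 (Nat.cast_nonneg _)
    rw [Es_succ_mul_J0_sub, inv_DeltaPs_kron]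
    calc _ ≤ ‖Bs o (lev L (k + 1)) M * siteMul (fun x' => T (k + 1) x' - T k (par (lev L k) L M x'))
            * (J0pcT L M k ⊗ₖ (1 : Matrix o o ℂ))‖ * ‖Gps (lev L k) M a' ⊗ₖ (1 : Matrix o o ℂ)‖ := Matrix.l2_opNorm_mul _ _
      _ ≤ (1 * (τ' / (lev L k : ℕ)) * 1) * (gammaPs d a')⁻¹ := by
          refine mul_le_mul ((Matrix.l2_opNorm_mul _ _).trans (mul_le_mul ((Matrix.l2_opNorm_mul _ _).trans (mul_le_mul
            (opNorm_Bs_le o _ M) (opNorm_siteMul_le _ hδ (hT.consistent k)) (norm_nonneg _) zero_le_one))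
            (opNorm_kron_le_of_le o (opNorm_JK0_le (lev L k) L M)) (norm_nonneg _) (by positivity)))
            (opNorm_kron_le_of_le o (opNorm_Gps_le _ M ha')) (norm_nonneg _) (by positivity)
      _ = _ := by ring
  inv_mul_pair_le := fun k => by
    have hg : 0 ≤ (gammaPs d a')⁻¹ := inv_nonneg.mpr (gammaPs_pos (d := d) (a' := a')).1.le
    have hδ : 0 ≤ τ' / (lev L k : ℕ) := div_nonneg hT.nonneg.2 (Nat.cast_nonneg _)
    rw [Es_succ_mul_J0_sub, inv_DeltaPs_kron, Matrix.conjTranspose_mul, Matrix.conjTranspose_mul, ← Matrix.mul_assoc, ← Matrix.mul_assoc]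
    calc _ ≤ ‖Gps (lev L k) M a' ⊗ₖ (1 : Matrix o o ℂ) * (J0pcT L M k ⊗ₖ (1 : Matrix o o ℂ))ᴴ
            * (siteMul (fun x' => T (k + 1) x' - T k (par (lev L k) L M x')))ᴴ‖ * ‖(Bs o (lev L (k + 1)) M)ᴴ‖ := Matrix.l2_opNorm_mul _ _
      _ ≤ ((gammaPs d a')⁻¹ * 1 * (τ' / (lev L k : ℕ))) * 1 := by
          refine mul_le_mul ((Matrix.l2_opNorm_mul _ _).trans (mul_le_mul ((Matrix.l2_opNorm_mul _ _).trans (mul_le_mul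
            (opNorm_kron_le_of_le o (opNorm_Gps_le _ M ha')) ?_ (norm_nonneg _) hg)) ?_ (norm_nonneg _) (by positivity))) ?_
            (norm_nonneg _) (by positivity)
          · rw [Matrix.l2_opNorm_conjTranspose]; exact opNorm_kron_le_of_le o (opNorm_JK0_le (lev L k) L M)
          · rw [Matrix.l2_opNorm_conjTranspose]; exact opNorm_siteMul_le _ hδ (hT.consistent k)
          · rw [Matrix.l2_opNorm_conjTranspose]; exact opNorm_Bs_le o _ M
      _ = _ := by ring

/-! ## §3 THE END: `PerturbationLaws` for the scalar layer -/

/-- **the consistency sequence of the scalar layer** (DISPLAYED; `g = γ′⁻¹`): the `n_k⁻¹`-part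
`(d·L·g·√g·β′ + d·√g·g·β′ + g²·ζ)/n_k` (two-level consistency of the connection and of the zeroth-order field), the complement part
`(d(L+1)α√g + d(L+1)(α√g + βg))·e₀ k`, and the Gram part `a′·e2gram g 1 τ e₀ e₁ 0 (g·τ′/n_k) k`. [folklore] -/
def e2S (d L : ℕ) (a' α β β' ζ τ τ' : ℝ) (e₀ e₁ : ℕ → ℝ) (k : ℕ) : ℝ :=
  (d * (L * (gammaPs d a')⁻¹ * Real.sqrt ((gammaPs d a')⁻¹) * β') + d * (Real.sqrt ((gammaPs d a')⁻¹) * (gammaPs d a')⁻¹ * β')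
      + (gammaPs d a')⁻¹ * (gammaPs d a')⁻¹ * ζ) / (lev L k : ℕ)
    + (d * ((L + 1) * α * Real.sqrt ((gammaPs d a')⁻¹)) + d * ((L + 1) * (α * Real.sqrt ((gammaPs d a')⁻¹) + β * (gammaPs d a')⁻¹))) * e₀ k
    + a' * e2gram (gammaPs d a')⁻¹ 1 τ e₀ e₁ (fun _ => 0) (fun j => (gammaPs d a')⁻¹ * (τ' / (lev L j : ℕ))) k

/-- its geometric constant (`n_k⁻¹ = L^{−k}`, `e₀ k ≤ C₀L^{−k}`, `e₁ k ≤ C₁L^{−k}`). [folklore] -/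
def C2S (d L : ℕ) (a' α β β' ζ τ τ' C₀ C₁ : ℝ) : ℝ :=
  (d * (L * (gammaPs d a')⁻¹ * Real.sqrt ((gammaPs d a')⁻¹) * β') + d * (Real.sqrt ((gammaPs d a')⁻¹) * (gammaPs d a')⁻¹ * β')
      + (gammaPs d a')⁻¹ * (gammaPs d a')⁻¹ * ζ)
    + (d * ((L + 1) * α * Real.sqrt ((gammaPs d a')⁻¹)) + d * ((L + 1) * (α * Real.sqrt ((gammaPs d a')⁻¹) + β * (gammaPs d a')⁻¹))) * C₀
    + a' * GramPerturbationLaw.C2gram (gammaPs d a')⁻¹ 1 τ C₀ C₁ 0 ((gammaPs d a')⁻¹ * τ')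

omit [NeZero L] hM in
/-- **GEOMETRIC CONSISTENCY**: geometric free defects give `e2S k ≤ C2S·L^{−k}`. [folklore] -/
theorem e2S_le_geom {a' α β β' ζ τ τ' C₀ C₁ : ℝ} (ha' : 0 < a') (hα : 0 ≤ α) (hβ : 0 ≤ β) (hτ : 0 ≤ τ) {e₀ e₁ : ℕ → ℝ}
    (h₀ : ∀ k, e₀ k ≤ C₀ * ((L : ℝ)⁻¹) ^ k) (h₁ : ∀ k, e₁ k ≤ C₁ * ((L : ℝ)⁻¹) ^ k) (k : ℕ) :
    e2S d L a' α β β' ζ τ τ' e₀ e₁ k ≤ C2S d L a' α β β' ζ τ τ' C₀ C₁ * ((L : ℝ)⁻¹) ^ k := by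
  have hg : 0 ≤ (gammaPs d a')⁻¹ := inv_nonneg.mpr (gammaPs_pos (d := d) (a' := a')).1.le
  have hρ : ∀ (j : ℕ) (x : ℝ), x / (lev L j : ℕ) = x * ((L : ℝ)⁻¹) ^ j := fun j x => by
    rw [cast_lev', div_eq_mul_inv, ← inv_pow]
  have hG : e2gram (gammaPs d a')⁻¹ 1 τ e₀ e₁ (fun _ => 0) (fun j => (gammaPs d a')⁻¹ * (τ' / (lev L j : ℕ))) k
      ≤ GramPerturbationLaw.C2gram (gammaPs d a')⁻¹ 1 τ C₀ C₁ 0 ((gammaPs d a')⁻¹ * τ') * ((L : ℝ)⁻¹) ^ k :=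
    GramPerturbationLaw.e2gram_le_geom hg zero_le_one hτ h₀ h₁ (fun j => by show (0 : ℝ) ≤ 0 * _; simp)
      (fun j => le_of_eq (by show (gammaPs d a')⁻¹ * (τ' / (lev L j : ℕ)) = _; rw [hρ j τ']; ring)) k
  have hB : 0 ≤ d * ((L + 1) * α * Real.sqrt ((gammaPs d a')⁻¹))
      + d * ((L + 1) * (α * Real.sqrt ((gammaPs d a')⁻¹) + β * (gammaPs d a')⁻¹)) := by positivity
  unfold e2S C2S
  rw [hρ k]
  refine (add_le_add (add_le_add le_rfl (mul_le_mul_of_nonneg_left (h₀ k) hB)) (mul_le_mul_of_nonneg_left hG ha'.le)).trans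
    (le_of_eq ?_)
  ring

/-- `‖(−X)ᴴ‖ = ‖X‖`. [folklore] -/
private theorem norm_negH (X : Matrix o o ℂ) : ‖(-X)ᴴ‖ = ‖X‖ := by
  rw [Matrix.conjTranspose_neg, norm_neg, Matrix.l2_opNorm_conjTranspose]

omit [Fintype o] [DecidableEq o] in
/-- `(−X)ᴴ − (−Y)ᴴ = (−(X − Y))ᴴ`. [folklore] -/
private theorem sub_negH (X Y : Matrix o o ℂ) : (-X)ᴴ - (-Y)ᴴ = (-(X - Y))ᴴ := by
  simp only [Matrix.conjTranspose_neg, Matrix.conjTranspose_sub, neg_sub]; abel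

/-- `‖−X − (−Y)‖ = ‖X − Y‖`. [folklore] -/
private theorem norm_neg_sub_neg (X Y : Matrix o o ℂ) : ‖-X - -Y‖ = ‖X - Y‖ := by
  rw [← norm_neg (X - Y)]; congr 1; abel

/-- `Fᴴ = Σ_μ (∂_μ ⊗ 1)ᴴ·siteMul((−w_μ)ᴴ)`. [folklore] -/
theorem FshapeH_eq (n : ℕ) [NeZero n] (Rb : Fin d → (Tor (fine n M) → Matrix o o ℂ)) :
    (Fshape (fine n M) ((n : ℕ) : ℂ) Rb)ᴴ
      = ∑ μ, (sdiff (fine n M) ((n : ℕ) : ℂ) μ ⊗ₖ (1 : Matrix o o ℂ))ᴴ * siteMul (fun x => (-(connS (fine n M) ((n : ℕ) : ℂ) Rb μ x))ᴴ) := by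
  rw [Fshape, Matrix.conjTranspose_sum]
  exact Finset.sum_congr rfl fun μ _ => by rw [Matrix.conjTranspose_mul, siteMul_conjTranspose]

/-- **ROW B4.e's END — `PerturbationLaws` FOR THE SCALAR LAYER.**  Given ANY lifted free scalar tower `hfree` (row B4.d's
`FreeTowerLaws` for `Δ′_k`, King's 0-form plantings `J₀,k`; only its complement / injected numbers `e₀`, `e₁` and `‖J₀‖ ≤ 1` are used),
connection data `(α, β, β′, ζ)` and site-transport data `(τ, τ′)`:
`PerturbationLaws (Δ′_k ⊗ 1) (scalarPert (lev L k) M a′ (R_k) (T_k)) (J₀,k ⊗ 1) (kappaS d a′ α β τ) (e2S d L a′ α β β′ ζ τ τ′ e₀ e₁)`.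
(H-bd) = `ScalarCovariantLaplacianBounds`; (H-cons) = `ScalarPlantingConsistency` (×3, summed over directions) + `GramPerturbationLaw`.
[cite: Balaban1985BackgroundPropagators, (3.19) p.393, (3.24) p.394 (shapes); King1986, (2.10) p.653 (planting)] [folklore] -/
theorem perturbationLaws_scalarLayer (hd : 1 ≤ d) {a' : ℝ} (ha' : 0 < a')
    {A : (k : ℕ) → Matrix (Tor (fine (lev L k) M) × o) (Tor (fine (lev L (k + 1)) M) × o) ℂ}
    {F : (k : ℕ) → Matrix (Tor (fine (lev L k) M) × o) (Tor (fine (lev L k) M) × o) ℂ} {r : ℝ} {e₀ e₁ f₀ : ℕ → ℝ}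
    (hfree : FreeTowerLaws (fun k => DeltaPs (lev L k) M a' ⊗ₖ (1 : Matrix o o ℂ)) A (fun k => J0pcT L M k ⊗ₖ (1 : Matrix o o ℂ)) F r e₀ e₁ f₀)
    {Rb : (k : ℕ) → Fin d → (Tor (fine (lev L k) M) → Matrix o o ℂ)} {T : (k : ℕ) → (Tor (fine (lev L k) M) → Matrix o o ℂ)}
    {α β β' ζ τ τ' : ℝ} (hR : ConnectionLaws0 L M Rb α β β' ζ) (hT : SiteTransportLaws0 L M T τ τ') :
    PerturbationLaws (fun k => DeltaPs (lev L k) M a' ⊗ₖ (1 : Matrix o o ℂ)) (fun k => scalarPert (lev L k) M a' (Rb k) (T k))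
      (fun k => J0pcT L M k ⊗ₖ (1 : Matrix o o ℂ)) (kappaS d a' α β τ) (e2S d L a' α β β' ζ τ τ' e₀ e₁) where
  opNorm_P_mul_inv_le := fun k =>
    opNorm_scalarPert_mul_inv_le (lev L k) M ha' hR.nonneg.1 hR.nonneg.2.1 hT.nonneg.1 (hR.bound k) (hR.lipschitz k) (hT.sub_one_le k)
  opNorm_inv_mul_P_le := fun k =>
    opNorm_inv_mul_scalarPert_le (lev L k) M ha' hR.nonneg.1 hR.nonneg.2.1 hT.nonneg.1 (hR.bound k) (hR.lipschitz k) (hT.sub_one_le k)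
  consistent_le := fun k => by
    obtain ⟨hα, hβ, hβ', hζ⟩ := hR.nonneg
    have hn : (0 : ℝ) < (lev L k : ℕ) := by exact_mod_cast one_le_lev' L k
    have hγ : ∀ j, ‖(DeltaPs (lev L j) M a' ⊗ₖ (1 : Matrix o o ℂ))⁻¹‖ ≤ (gammaPs d a')⁻¹ := fun j => by
      rw [inv_DeltaPs_kron]; exact opNorm_kron_le_of_le o (opNorm_Gps_le _ M ha')
    -- the Gram summand, from `GramPerturbationLaw`
    have hG := (perturbationLaws_gramPert hfree hγ (averagingLaws_Bs L M a') (averagingLaws_Es L M ha' hT) ((a' : ℝ) : ℂ)).consistent_le k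
    simp only [gramPert, gramCore, Bs_add_Es, inv_DeltaPs_kron, Complex.norm_real, Real.norm_of_nonneg ha'.le] at hG
    -- the complement number of the free tower in the two-level currency
    have hc0 := hfree.complement_le k
    simp only [inv_DeltaPs_kron, kron_conjTranspose] at hc0
    rw [← kron_mul, J0pcT_mul_conjTranspose] at hc0
    have hc : ‖(Gps (L * lev L k) M a' * (1 - Pi0 (lev L k) L M)) ⊗ₖ (1 : Matrix o o ℂ)‖ ≤ e₀ k := by
      rw [kron_mul, sub_kronecker, Matrix.one_kronecker_one]; exact hc0
    -- the three local pieces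
    have h1 : ‖Gps (lev L (k + 1)) M a' ⊗ₖ (1 : Matrix o o ℂ)
        * (Fshape (fine (lev L (k + 1)) M) ((lev L (k + 1) : ℕ) : ℂ) (Rb (k + 1)) * J0pcT L M k ⊗ₖ (1 : Matrix o o ℂ)
          - J0pcT L M k ⊗ₖ (1 : Matrix o o ℂ) * Fshape (fine (lev L k) M) ((lev L k : ℕ) : ℂ) (Rb k))
        * (Gps (lev L k) M a' ⊗ₖ (1 : Matrix o o ℂ))‖
        ≤ d * (L * (gammaPs d a')⁻¹ * (β' / (lev L k : ℕ)) * Real.sqrt ((gammaPs d a')⁻¹)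
          + e₀ k * (L + 1) * α * Real.sqrt ((gammaPs d a')⁻¹)) := by
      rw [Fshape, Fshape]
      refine (opNorm_cons_sum_le _ _ _ _ _ _).trans ?_
      have hterm : ∀ μ ∈ Finset.univ, ‖Gps (lev L (k + 1)) M a' ⊗ₖ (1 : Matrix o o ℂ)
          * (siteMul (fun x => -(connS (fine (lev L (k + 1)) M) ((lev L (k + 1) : ℕ) : ℂ) (Rb (k + 1)) μ x))
              * sdiff (fine (lev L (k + 1)) M) ((lev L (k + 1) : ℕ) : ℂ) μ ⊗ₖ (1 : Matrix o o ℂ) * J0pcT L M k ⊗ₖ (1 : Matrix o o ℂ)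
            - J0pcT L M k ⊗ₖ (1 : Matrix o o ℂ) * (siteMul (fun x => -(connS (fine (lev L k) M) ((lev L k : ℕ) : ℂ) (Rb k) μ x))
              * sdiff (fine (lev L k) M) ((lev L k : ℕ) : ℂ) μ ⊗ₖ (1 : Matrix o o ℂ)))
          * (Gps (lev L k) M a' ⊗ₖ (1 : Matrix o o ℂ))‖
          ≤ L * (gammaPs d a')⁻¹ * (β' / (lev L k : ℕ)) * Real.sqrt ((gammaPs d a')⁻¹)
            + e₀ k * (L + 1) * α * Real.sqrt ((gammaPs d a')⁻¹) := by
        intro μ _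
        refine opNorm_consistency0_le (lev L k) L M hd (one_le_lev' L k) ha' μ hα (div_nonneg hβ' hn.le) (fun x => ?_) (fun x' => ?_) hc
        · simpa only [norm_neg] using hR.bound k μ x
        · simpa only [norm_neg_sub_neg] using hR.consistent k μ x'
      refine (Finset.sum_le_sum hterm).trans (le_of_eq ?_)
      rw [Finset.sum_const, Finset.card_univ, Fintype.card_fin, nsmul_eq_mul]
    have h2 : ‖Gps (lev L (k + 1)) M a' ⊗ₖ (1 : Matrix o o ℂ)
        * ((Fshape (fine (lev L (k + 1)) M) ((lev L (k + 1) : ℕ) : ℂ) (Rb (k + 1)))ᴴ * J0pcT L M k ⊗ₖ (1 : Matrix o o ℂ)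
          - J0pcT L M k ⊗ₖ (1 : Matrix o o ℂ) * (Fshape (fine (lev L k) M) ((lev L k : ℕ) : ℂ) (Rb k))ᴴ)
        * (Gps (lev L k) M a' ⊗ₖ (1 : Matrix o o ℂ))‖
        ≤ d * (Real.sqrt ((gammaPs d a')⁻¹) * (β' / (lev L k : ℕ)) * (gammaPs d a')⁻¹
          + e₀ k * (L + 1) * (α * Real.sqrt ((gammaPs d a')⁻¹) + β * (gammaPs d a')⁻¹)) := by
      rw [FshapeH_eq, FshapeH_eq]
      refine (opNorm_cons_sum_le _ _ _ _ _ _).trans ?_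
      have hterm : ∀ μ ∈ Finset.univ, ‖Gps (lev L (k + 1)) M a' ⊗ₖ (1 : Matrix o o ℂ)
          * ((sdiff (fine (lev L (k + 1)) M) ((lev L (k + 1) : ℕ) : ℂ) μ ⊗ₖ (1 : Matrix o o ℂ))ᴴ
              * siteMul (fun x => (-(connS (fine (lev L (k + 1)) M) ((lev L (k + 1) : ℕ) : ℂ) (Rb (k + 1)) μ x))ᴴ)
              * J0pcT L M k ⊗ₖ (1 : Matrix o o ℂ)
            - J0pcT L M k ⊗ₖ (1 : Matrix o o ℂ) * ((sdiff (fine (lev L k) M) ((lev L k : ℕ) : ℂ) μ ⊗ₖ (1 : Matrix o o ℂ))ᴴ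
              * siteMul (fun x => (-(connS (fine (lev L k) M) ((lev L k : ℕ) : ℂ) (Rb k) μ x))ᴴ)))
          * (Gps (lev L k) M a' ⊗ₖ (1 : Matrix o o ℂ))‖
          ≤ Real.sqrt ((gammaPs d a')⁻¹) * (β' / (lev L k : ℕ)) * (gammaPs d a')⁻¹
            + e₀ k * (L + 1) * (α * Real.sqrt ((gammaPs d a')⁻¹) + β * (gammaPs d a')⁻¹) := by
        intro μ _
        refine opNorm_adjoint_consistency0_le (lev L k) L M hd (one_le_lev' L k) ha' μ hα hβ (div_nonneg hβ' hn.le) (fun x => ?_)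
          (fun x => ?_) (fun x' => ?_) hc
        · simpa only [norm_negH] using hR.bound k μ x
        · simpa only [sub_negH, norm_negH] using hR.lipschitz k μ μ x
        · simpa only [Function.comp_apply, sub_negH, norm_negH] using hR.consistent k μ x'
      refine (Finset.sum_le_sum hterm).trans (le_of_eq ?_)
      rw [Finset.sum_const, Finset.card_univ, Fintype.card_fin, nsmul_eq_mul]
    have h3 : ‖Gps (lev L (k + 1)) M a' ⊗ₖ (1 : Matrix o o ℂ)
        * (siteMul (zfieldS (fine (lev L (k + 1)) M) ((lev L (k + 1) : ℕ) : ℂ) (Rb (k + 1))) * J0pcT L M k ⊗ₖ (1 : Matrix o o ℂ)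
          - J0pcT L M k ⊗ₖ (1 : Matrix o o ℂ) * siteMul (zfieldS (fine (lev L k) M) ((lev L k : ℕ) : ℂ) (Rb k)))
        * (Gps (lev L k) M a' ⊗ₖ (1 : Matrix o o ℂ))‖
        ≤ (gammaPs d a')⁻¹ * (ζ / (lev L k : ℕ)) * (gammaPs d a')⁻¹ :=
      opNorm_zeroth_consistency0_le (lev L k) L M ha' (div_nonneg hζ hn.le) (hR.zeroth_consistent k)
    -- assemble
    rw [inv_DeltaPs_kron, inv_DeltaPs_kron, scalarPert_eq, scalarPert_eq]
    refine ((opNorm_cons_add_le _ _ _ _ _ _ _).trans (add_le_add ((opNorm_cons_add_le _ _ _ _ _ _ _).trans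
      (add_le_add ((opNorm_cons_add_le _ _ _ _ _ _ _).trans (add_le_add h1 h2)) h3)) hG)).trans (le_of_eq ?_)
    unfold e2S
    ring

end Tower

end Summit.QuantumFields.BalabanUV.T4Continuum.ScalarCovariantLaplacianLaws

end
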